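import Summits.HodgeConjecture.HodgeConjecture.Theorems.Ring2MotivProductCMFactor
import Summits.HodgeConjecture.HodgeConjecture.Theorems.Ring2MotivProductCMFactorClasses
import Summits.HodgeConjecture.HodgeConjecture.Theorems.Ring2MotivProductCellsFrame
import Summits.HodgeConjecture.HodgeConjecture.Theorems.Ring2MotivMurtyTypeCells
import Literature.AlgebraicGeometry.HodgeTheory.NoTypeIVTimesCMProductSpan
import HarnessLib

/-!
# Ring 2 · route `motiv` — the product lane with the Lombardo binder `hL` DISCHARGED

HONEST FRAMING: research route conditional on HC_CM; not a corollary; Q11.4-sentence-2 already refuted in dim ≥ 3.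

Cell `pub-hodge-ring2`, seat `pub-hodge-ring2-motiv` (gen 109). The product lane of this route
(`Ring2MotivProductCMFactor`, `Ring2MotivProductCMFactorClasses`, `Ring2MotivProductCells`,
`Ring2MotivProductCellsFrame`, `Ring2MotivProductCellsDiscOne`, `Ring2MotivMurtyTypeCells`) displays the printed
splitting / generation fact

* `HodgeTheory.Lombardo2016_hodgeClassesProductSpan :
    ∀ A C, HasNoTypeIVFactor A → Milne1999.IsOfCMType C → HodgeClassesProductSpan A C`

(Lombardo 2016 Lemma 3.4: for `C` of CM type and `A` without simple factor of type IV, `Hg(A × C) = Hg(A) × Hg(C)`;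
read through Moonen–Zarhin 1999 (3.1): then the Hodge ring of `A × C` is generated by the factors) as a HYPOTHESIS
`hL` of every row. Since 2026-08-22 that named fact is a THEOREM of the tree,
`HodgeTheory.Lombardo2016_hodgeClassesProductSpan_holds`
(`Literature/AlgebraicGeometry/HodgeTheory/NoTypeIVTimesCMProductSpan.lean`, Literature cell, programme R5).
This file is the ONE downstream consumer on the summit side (cell LEAD ruling F-LEAD-85-1): the headline `hL`
rows restated with `hL := Lombardo2016_hodgeClassesProductSpan_holds`, under NEW names, no row edited in place.
Every proof is a one-line instantiation; no definition; no new named fact.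

WHAT CHANGES AND WHAT DOES NOT. Only the Literature binder `hL` disappears. `HC_CM` — the tree item
`Theses.RankFourFaces.CMAbelianHodge` (stmt-HodgeConjecture-3052; Milne's per-variety form by `Iff.rfl`) — stays
an explicit HYPOTHESIS `hCM` wherever a row used it, used exactly once per row (for the CM factor); it is never an
axiom and never "known". The other printed inputs that are still named facts of the tree (Murty 1988 Thm. 2,
Floccari–Fu 2026 Thm. 1.2, the Markman 2025 claim) stay explicit binders `hM`, `h5`, `hMk`.

## Content

* `cellProductSpan_of_hasNoTypeIVFactor` : the cell-level splitting hypothesis `CellProductSpan 𝒜` is a THEOREM for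
  every class `𝒜 ⊆ {no simple factor of type IV}` (was `cellProductSpan_of_lombardo hL`).
* `hodgeConjectureFor_prod_of_cmAbelianHodge_of_hasNoTypeIVFactor` : `HC_CM → (A without type-IV factor) →
  (C of CM type) → HC(A) → HC(A × C)` — the frame of the lane, now with `HC_CM` as its ONLY non-structural
  hypothesis; `…_of_dim_le_three` : `HC_CM → HC(A × C)` for `dim A ≤ 3` (refereed inputs only besides `HC_CM`);
  `…_of_dim_le_five_of` : the same for `dim A ≤ 5` on the Markman 2025 claim (binder `hMk`, UNREFEREED).
* `cmAbelianHodge_iff_forall_prod_cmType_of_hasNoTypeIVFactor` (and `…_of_dim_le_three`) : EXACTNESS —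
  `HC_CM ⟺ HC on the slice {A₀ × C : C of CM type}` for any one `A₀` without type-IV factor satisfying HC
  (resp. of dimension `≤ 3`): an unconditional equivalence, neither side asserted.
* `hodgeConjectureFor_of_prodCMCell_noTypeIV_of_cmAbelianHodge`, `hcOnClass_prodCMCell_noTypeIV_top_iff` : the
  isogeny-closed cell `𝒜 × (CM ∩ 𝒞)` versions (class-target spelling `HCOnClass`).
* `forall_prodCMCell_murtyTypePow_noTypeIV_top_iff_cmAbelianHodge_of_murty1988`,
  `hodgeConjectureFor_of_prodCMCell_discOneWeilPower_of_floccariFu` : the Murty-type and discriminant-one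
  Weil-power cells with `hL` discharged (their own printed facts remain binders).
* ON-PATH: every conclusion is literally a consequence of the summit statement (`dischargedRows_onPath`, and the
  lane's `hodgeConjectureFor_prod_of_hodgeConjecture`, `prodCMCell_rows_of_hodgeConjecture`).

Which hypotheses survive the Q11.4 no-go: all — no transport, deformation or semiregularity is used. Limitation
unchanged (cell RING2-MAP.md §motiv M-C): the lane never produces a non-product Hodge class; simple non-CM Weil
type and the non-split sector stay out of reach.

References: Lombardo2016 (Ann. Inst. Fourier 66 (2016) Lemma 3.4, p. 1229 = arXiv:1402.1478 Lemma 35);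
MoonenZarhin1999LowDim (§3 (3.1), Introduction); Milne1999 (§7 (H)); Murty1988 (Thm. 2); FloccariFu2026
(Thm. 1.2); Fulton1998 (§10.1 Example 10.1.2, §19.2); Deligne2000 (§1).
-/

set_option linter.dupNamespace false

noncomputable section

open CategoryTheory
open Literature.AlgebraicGeometry Literature.AlgebraicGeometry.Motives
open Literature.AlgebraicGeometry.HodgeTheory
open Literature.AlgebraicGeometry.Milne1999
open Summit.HodgeConjecture.HodgeConjecture.Theses
open Summit.HodgeConjecture.HodgeConjecture.Ring2.ClassTargets

namespace Summit.HodgeConjecture.HodgeConjecture.Ring2.Motiv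

variable {𝒜 𝒞 : AbelianVariety ℂ → Prop}

/-! ## §1 The splitting hypothesis of the no-type-IV cells is a theorem -/

/-- **`CellProductSpan 𝒜` for every `𝒜 ⊆ {A without simple factor of type IV}`** — the cell's splitting
hypothesis DISCHARGED by the tree theorem `Lombardo2016_hodgeClassesProductSpan_holds` (was
`cellProductSpan_of_lombardo hL`). [cite: Lombardo2016, Lemma 3.4 (p. 1229)] [cite: MoonenZarhin1999LowDim, §3 (3.1)] -/
theorem cellProductSpan_of_hasNoTypeIVFactor (h𝒜4 : ∀ A, 𝒜 A → HasNoTypeIVFactor A) : CellProductSpan 𝒜 :=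
  cellProductSpan_of_lombardo Lombardo2016_hodgeClassesProductSpan_holds h𝒜4

/-! ## §2 The frame rows (`Ring2MotivProductCMFactor`) without `hL` -/

/-- **HC(`A × C`) from `HC_CM` through the CM factor, no Literature binder.** For `A` without simple factor of
type IV satisfying HC and `C` of CM type: `HC_CM` (tree item `RankFourFaces.CMAbelianHodge`, a HYPOTHESIS, used
once — for HC(`C`)) gives HC for `A.prod C`. [cite: Lombardo2016, Lemma 3.4 (p. 1229)] [cite: Milne1999, §7 p. 72] -/
theorem hodgeConjectureFor_prod_of_cmAbelianHodge_of_hasNoTypeIVFactor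
    (hCM : RankFourFaces.CMAbelianHodge) (A C : AbelianVariety ℂ) (hA4 : HasNoTypeIVFactor A)
    (hCt : IsOfCMType C) (hA : HodgeConjectureFor A.dim A.X) :
    HodgeConjectureFor (A.prod C).dim (A.prod C).X :=
  hodgeConjectureFor_prod_of_cmAbelianHodge hCM Lombardo2016_hodgeClassesProductSpan_holds A C hA4 hCt hA

/-- **`dim A ≤ 3`: `HC_CM → HC(A × C)`**, `A` without type-IV factor, `C` of CM type of any dimension — refereed
inputs only besides the hypothesis `HC_CM` (HC(`A`) is the tree theorem `hodgeConjectureFor_of_dim_le_three_holds`).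
The ring-2 content sits where `C` has dimension `≥ 4` and exceptional Hodge classes.
[cite: MoonenZarhin1999LowDim, Introduction and §3 (3.1)] [cite: Lombardo2016, Lemma 3.4 (p. 1229)] -/
theorem hodgeConjectureFor_prod_of_cmAbelianHodge_of_hasNoTypeIVFactor_of_dim_le_three
    (hCM : RankFourFaces.CMAbelianHodge) (A C : AbelianVariety ℂ) (hA4 : HasNoTypeIVFactor A)
    (hCt : IsOfCMType C) (hd : A.dim ≤ 3) :
    HodgeConjectureFor (A.prod C).dim (A.prod C).X :=
  hodgeConjectureFor_prod_of_cmAbelianHodge_of_dim_le_three hCM Lombardo2016_hodgeClassesProductSpan_holds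
    A C hA4 hCt hd

/-- **`dim A ≤ 5`, on the Markman 2025 claim** (binder `hMk`, UNREFEREED named claim-fact
`Markman2025_hodgeClasses_algebraic_abelian_dim_le_five`; `HC_CM` a hypothesis; no `hL`).
[claim: Markman2025SurveySecant, status: under-review] [cite: MoonenZarhin1999LowDim, main theorem]
[cite: Lombardo2016, Lemma 3.4 (p. 1229)] -/
theorem hodgeConjectureFor_prod_of_cmAbelianHodge_of_hasNoTypeIVFactor_of_dim_le_five_of
    (hCM : RankFourFaces.CMAbelianHodge) (hMk : Markman2025_hodgeClasses_algebraic_abelian_dim_le_five)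
    (A C : AbelianVariety ℂ) (hA4 : HasNoTypeIVFactor A) (hCt : IsOfCMType C) (hd : A.dim ≤ 5) :
    HodgeConjectureFor (A.prod C).dim (A.prod C).X :=
  hodgeConjectureFor_prod_of_cmAbelianHodge_of_dim_le_five_of hCM Lombardo2016_hodgeClassesProductSpan_holds
    hMk A C hA4 hCt hd

/-! ## §3 EXACTNESS without `hL`: `HC_CM` is necessary and sufficient on the slice -/

/-- **`HC_CM ⟺ HC on the slice `{A₀ × C : C of CM type}`**, for ANY ONE complex abelian variety `A₀` without
type-IV factor satisfying HC — an unconditional equivalence (neither side asserted; was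
`cmAbelianHodge_iff_forall_prod_cmType hL`). [cite: Lombardo2016, Lemma 3.4 (p. 1229)] [cite: Milne1999, §7 p. 72]
[cite: Fulton1998, §10.1 Example 10.1.2] -/
theorem cmAbelianHodge_iff_forall_prod_cmType_of_hasNoTypeIVFactor (A₀ : AbelianVariety ℂ)
    (h₀4 : HasNoTypeIVFactor A₀) (h₀ : HodgeConjectureFor A₀.dim A₀.X) :
    RankFourFaces.CMAbelianHodge ↔
      ∀ C : AbelianVariety ℂ, IsOfCMType C → HodgeConjectureFor (A₀.prod C).dim (A₀.prod C).X :=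
  cmAbelianHodge_iff_forall_prod_cmType Lombardo2016_hodgeClassesProductSpan_holds A₀ h₀4 h₀

/-- **The slice equivalence at `dim A₀ ≤ 3`** — no hypothesis at all beyond `A₀` having no type-IV factor:
`HC_CM ⟺ ∀ C of CM type, HC(A₀ × C)`. [cite: MoonenZarhin1999LowDim, Introduction and §3 (3.1)]
[cite: Lombardo2016, Lemma 3.4 (p. 1229)] -/
theorem cmAbelianHodge_iff_forall_prod_cmType_of_hasNoTypeIVFactor_of_dim_le_three (A₀ : AbelianVariety ℂ)
    (hd : A₀.dim ≤ 3) (h₀4 : HasNoTypeIVFactor A₀) :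
    RankFourFaces.CMAbelianHodge ↔
      ∀ C : AbelianVariety ℂ, IsOfCMType C → HodgeConjectureFor (A₀.prod C).dim (A₀.prod C).X :=
  cmAbelianHodge_iff_forall_prod_cmType_of_dim_le_three Lombardo2016_hodgeClassesProductSpan_holds A₀ hd h₀4

/-! ## §4 The isogeny-closed cells (`Ring2MotivProductCells`, `…CellsFrame`) without `hL` -/

/-- **HC on the cell `(𝒜 ∩ no-type-IV) × (CM ∩ 𝒞)` from `HC_CM` and HC on the left class** (was
`hodgeConjectureFor_of_prodCMCell_noTypeIV_of_cmAbelianHodge_of_lombardo hCM hL`).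
[cite: Lombardo2016, Lemma 3.4 (p. 1229)] [cite: Milne1999, §7 p. 72] -/
theorem hodgeConjectureFor_of_prodCMCell_noTypeIV_of_cmAbelianHodge
    (hCM : RankFourFaces.CMAbelianHodge)
    (h𝒜 : ∀ A : AbelianVariety ℂ, 𝒜 A ∧ HasNoTypeIVFactor A → HodgeConjectureFor A.dim A.X)
    {X : AbelianVariety ℂ} (hX : ProdCMCell (fun A ↦ 𝒜 A ∧ HasNoTypeIVFactor A) 𝒞 X) :
    HodgeConjectureFor X.dim X.X :=
  hodgeConjectureFor_of_prodCMCell_noTypeIV_of_cmAbelianHodge_of_lombardo hCM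
    Lombardo2016_hodgeClassesProductSpan_holds h𝒜 hX

/-- **EXACTNESS on the full cell, class-target spelling**: given one member of the left class and one CM abelian
variety, `HC(ProdCMCell (𝒜 ∩ no-type-IV) ⊤) ⟺ HCOnClass (𝒜 ∩ no-type-IV) ∧ HC_CM` — unconditional (was
`hcOnClass_prodCMCell_noTypeIV_top_iff_of_lombardo hL`). [cite: Lombardo2016, Lemma 3.4 (p. 1229)]
[cite: Milne1999, §7 p. 72] [cite: Fulton1998, §10.1 Example 10.1.2] -/
theorem hcOnClass_prodCMCell_noTypeIV_top_iff
    (hA₀ : ∃ A : AbelianVariety ℂ, 𝒜 A ∧ HasNoTypeIVFactor A) (hC₀ : ∃ C : AbelianVariety ℂ, IsOfCMType C) :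
    HCOnClass (ProdCMCell (fun A ↦ 𝒜 A ∧ HasNoTypeIVFactor A) fun _ ↦ True) ↔
      HCOnClass (fun A ↦ 𝒜 A ∧ HasNoTypeIVFactor A) ∧ RankFourFaces.CMAbelianHodge :=
  hcOnClass_prodCMCell_noTypeIV_top_iff_of_lombardo Lombardo2016_hodgeClassesProductSpan_holds hA₀ hC₀

/-! ## §5 The Murty-type and discriminant-one Weil-power cells without `hL` -/

/-- **EXACTNESS on the Murty-type product cells, modulo Murty's theorem only**: given one member of the left class
and one CM abelian variety, HC on the cells `(B ~ A^{N+1}, A of Murty type, B without type-IV factor) × CM` is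
EQUIVALENT to `HC_CM` (binder `hM` = Murty 1988 Thm. 2, a theorem in print; `hL` discharged).
[cite: Murty1988, Thm. 2] [cite: Lombardo2016, Lemma 3.4 (p. 1229)] [cite: Milne1999, §7 p. 72] -/
theorem forall_prodCMCell_murtyTypePow_noTypeIV_top_iff_cmAbelianHodge_of_murty1988
    (hM : Murty1988_hodgeClasses_divisorial_powers_totallyRealMaxSubfield_oddHalfRank)
    (hA₀ : ∃ B : AbelianVariety ℂ, (∃ (A : AbelianVariety ℂ) (N : ℕ), HasTotallyRealOddMaxSubfield A ∧
      AbelianVariety.IsIsogenous B (A.powSucc N)) ∧ HasNoTypeIVFactor B)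
    (hC₀ : ∃ C : AbelianVariety ℂ, IsOfCMType C) :
    (∀ X : AbelianVariety ℂ,
        ProdCMCell (fun B ↦ (∃ (A : AbelianVariety ℂ) (N : ℕ), HasTotallyRealOddMaxSubfield A ∧
          AbelianVariety.IsIsogenous B (A.powSucc N)) ∧ HasNoTypeIVFactor B) (fun _ ↦ True) X →
        HodgeConjectureFor X.dim X.X) ↔ RankFourFaces.CMAbelianHodge :=
  forall_prodCMCell_murtyTypePow_noTypeIV_top_iff_cmAbelianHodge Lombardo2016_hodgeClassesProductSpan_holds
    hM hA₀ hC₀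

/-- **HC on the cells `𝒜 × (discriminant-one CM Weil fourfold)^(k+1)`** for `𝒜 ⊆ {no type-IV factor}` satisfying
HC, modulo Floccari–Fu 2026 Thm. 1.2 only (binder `h5`; `hL` discharged; no `HC_CM`).
[cite: FloccariFu2026, Theorem 1.2] [cite: Lombardo2016, Lemma 3.4 (p. 1229)] -/
theorem hodgeConjectureFor_of_prodCMCell_discOneWeilPower_of_floccariFu
    (h5 : FloccariFu2026_hodgeClasses_algebraic_powers_discOneWeilFourfold)
    (h𝒜4 : ∀ A, 𝒜 A → HasNoTypeIVFactor A)
    (h𝒜 : ∀ A : AbelianVariety ℂ, 𝒜 A → HodgeConjectureFor A.dim A.X)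
    {X : AbelianVariety ℂ} (hX : ProdCMCell 𝒜 DiscOneWeilPowerClass X) : HodgeConjectureFor X.dim X.X :=
  hodgeConjectureFor_of_prodCMCell_discOneWeilPower_of_lombardo Lombardo2016_hodgeClassesProductSpan_holds
    h5 h𝒜4 h𝒜 hX

/-! ## §6 On-path audit -/

/-- ON-PATH: the summit statement gives the conclusion of every row above AND the hypothesis `HC_CM`, so no row
is beside the path to the summit and the equivalences of §3–§5 claim nothing beyond it on either side. [folklore] -/
theorem dischargedRows_onPath (h : _root_.HodgeConjecture) (A C : AbelianVariety ℂ) :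
    HodgeConjectureFor (A.prod C).dim (A.prod C).X ∧ RankFourFaces.CMAbelianHodge ∧
      ∀ X : AbelianVariety ℂ, ProdCMCell 𝒜 𝒞 X → HodgeConjectureFor X.dim X.X :=
  ⟨hodgeConjectureFor_prod_of_hodgeConjecture h A C, cmAbelianHodge_of_hodgeConjecture h,
    (prodCMCell_rows_of_hodgeConjecture h 𝒜 𝒞).1⟩

end Summit.HodgeConjecture.HodgeConjecture.Ring2.Motiv

end
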